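import Literature.AlgebraicGeometry.AbelianSchemes.SerreTranslateCoverLeg                 -- ★ `surjective_baseChangeHom_left`; re-exports ★ `SerreTwistBaseChange` (`DualPair.baseChangeHom_similitude_base`)
import Literature.AlgebraicGeometry.AbelianSchemes.IsogenyRoofTransportAlongIso             -- ★ the ROOF SHAPE (`roof_transport_along_iso`), `map_one_of_isMonHom`
import Literature.AlgebraicGeometry.AbelianSchemes.AbelianSchemeDualTransportOfBaseChange   -- ★ `DualPair.nonempty_unitHatSlice_baseChange_iso`
import Literature.AlgebraicGeometry.AbelianSchemes.LevelStructureOfTorsionBasis             -- ★ `specOver_self_hom` (`(Spec K → Spec K) = 𝟙`)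
import HarnessLib

/-!
# An ISOGENY ROOF over `Spec Ω` BASE-CHANGES along an isomorphism of point bases `Spec Ω′ ≅ Spec Ω` (the `Ω`-points move by the TRANSFER of points)

Topic `AlgebraicGeometry/AbelianSchemes`; namespace `Literature.AlgebraicGeometry.AbelianSchemes.AbelianSchemeOver`.  THEOREMS ONLY (no definition,
no named fact, no instance, no notation, no `sorry`).  Cell `hodgecm-mathlib` (D-0151), P6 «MOD programme» (crux hLiu418 = stmt-HodgeConjecture-24832,
`--supports`, count-neutral), line «L4», X-LEAF `Lines/F0_P6a_EExports.lean` (A-p01 (g28)) socket `stub_ECtoΩ` «transport of the E-readings `RoofE` ∕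
`HeckeRoofsE` from `ℂ`-points to `F̄_w`-points along a ring isomorphism `σ : F̄_w ≃ ℂ` over `ι₁`» (LA4-plan (g0) DEAL #20′ (ii); the `σ` is ★
`AdicCompletionAlgClosureEquivComplex`).  This file is the GENERIC CORE of that transport: the roof SHAPE of ★ `IsogenyRoofTransportAlongIso` (clauses
(r1)–(r5) of the P6a readers `RoofΩ`∕`RoofE`, readers abstracted) moves along the base change `Spec σ : Spec Ω′ → Spec Ω` of the point base; the X-leaf
composes it with ★ `tupleRel_baseChangeCompGrpIso_hom∕_inv` + ★ `roof_transport_along_iso` (to re-read `(𝒜 ×_X Spec Ω) ×_Ω Spec Ω′` as `𝒜 ×_X Spec Ω′`).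
HC_CM is proved only modulo the 2 remaining named inputs (hLiu418 24832, h413 24833) until rung 0 closes; nothing here is about HC.

THE MATHEMATICS ([GortzWedhorn2020] (4.7), Prop. 4.16: base change is a functor, an isomorphism of bases induces an equivalence; [MumfordFogartyKirwan1994]
Ch. 6 §1 Cor. 6.4, 6.8: homomorphisms, unit sections and dual abelian schemes base-change; Ch. 7 §2 Def. 7.2).  Let `e : Spec Ω′ → Spec Ω` be a morphism of
spectra of fields and `A` an abelian scheme over `Spec Ω`.  A TRANSFER OF POINTS is a map `ε : A(Ω) → A_{Ω′}(Ω′)` with `pr_A ∘ ε(P) = e ≫ P` (§1: such a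
map exists, is unique, is MULTIPLICATIVE — it is `P ↦ P ×_Ω Ω′` — NATURAL in homomorphisms `f : A → B` (`ε_B(f P) = f_{Ω′}(ε_A P)`), hence preserves and
detects torsion conditions `ι(a)P = 1`, and is BIJECTIVE when `e` is an isomorphism).  §2: every clause of an isogeny roof `A —q→ B ←c— A″` over `Spec Ω`
(kernels on `Ω`-points, surjectivity of `c`, the similitude laws `q^*λ_B = p·λ`, `c^*λ_B = p·λ″`, `ι`-equivariance through a common endomorphism of `B`,
equality of level points) base-changes along `e` to the same clause for `A_{Ω′} —q_{Ω′}→ B_{Ω′} ←c_{Ω′}— A″_{Ω′}` with the `Ω′`-point data moved by the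
transfers (★ `DualPair.baseChangeHom_similitude_base` for the `λ`-laws, ★ `surjective_baseChangeHom_left`, ★ `DualPair.nonempty_unitHatSlice_baseChange_iso`
for the unit pin of `B̂`); `e` an isomorphism makes the transfers onto, so the `Ω′`-point clauses are exhausted.

* §1 transfers: `exists_pointsTransfer`, `pointsTransfer_ext` (uniqueness), `pointsTransfer_map` (naturality), `pointsTransfer_mul`, `pointsTransfer_one`,
  `pointsTransfer_map_eq_one_iff`, `pointsTransfer_forall_map_eq_one_iff` (torsion), `pointsTransfer_injective`, `pointsTransfer_surjective_of_isIso`;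
* §2 **`roof_baseChange_of_isIso`** — THE HEAD (roof shape over `Ω` ⟹ roof shape over `Ω′` for the base-changed sides, the same middle base-changed).

## References
* [GortzWedhorn2020] U. Görtz, T. Wedhorn, *Algebraic Geometry I*, 2nd ed. (2020), Section (4.7) (pp. 107–108), Prop. 4.16 (p. 101).
* [MumfordFogartyKirwan1994] D. Mumford, J. Fogarty, F. Kirwan, *Geometric Invariant Theory*, 3rd ed. (1994), Ch. 6 §1 Cor. 6.4 (p. 117), Cor. 6.8 (p. 118);
  Ch. 7 §2 Def. 7.2 (p. 129).
* [MumfordAV1970] D. Mumford, *Abelian Varieties* (1970), §15 Thm. 1 (p. 143).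
-/

set_option autoImplicit false

noncomputable section

-- Mathlib's `Over`/pull-back API is stated across semireducible wrappers (as in the ★ `AbelianSchemes/*` files).
set_option backward.isDefEq.respectTransparency false

universe u

open CategoryTheory CategoryTheory.Limits AlgebraicGeometry MonoidalCategory
open scoped MonObj Obj

namespace Literature.AlgebraicGeometry.AbelianSchemes

namespace AbelianSchemeOver

open Literature.AlgebraicGeometry.Motives (AlgPoints specOver)

/-! ### §1 Transfers of `Ω`-points along a base change `e : Spec Ω′ → Spec Ω` -/

section Transfer

variable {Ω Ω' : Type u} [Field Ω] [Field Ω'] (e : Spec (.of Ω') ⟶ Spec (.of Ω)) {A B : AbelianSchemeOver (Spec (.of Ω))}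

/-- The structure square of an `Ω`-point pushed along `e`: `(e ≫ P) ≫ (A → Spec Ω) = 𝟙 ≫ e`. [cite: GortzWedhorn2020, Section (4.7) (pp. 107–108)] -/
theorem pointsTransfer_structure_square (P : A.toAffine.toAbelianVariety.Points Ω) :
    (e ≫ P.left) ≫ A.X.hom = (specOver Ω' Ω').hom ≫ e := by
  have hP : P.left ≫ A.X.hom = 𝟙 _ := (Over.w P).trans (specOver_self_hom (K := Ω))
  erw [specOver_self_hom, Category.id_comp, Category.assoc, hP, Category.comp_id]

/-- **A TRANSFER OF POINTS EXISTS**: `P ↦ (e ≫ P, 𝟙) ∈ A_{Ω′}(Ω′)`. [cite: GortzWedhorn2020, Section (4.7) (pp. 107–108)] -/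
theorem exists_pointsTransfer (A : AbelianSchemeOver (Spec (.of Ω))) :
    ∃ ε : A.toAffine.toAbelianVariety.Points Ω → (A.baseChange e).toAffine.toAbelianVariety.Points Ω',
      ∀ P, (ε P).left ≫ pullback.fst A.X.hom e = e ≫ P.left :=
  ⟨fun P => Over.homMk (pullback.lift (e ≫ P.left) (specOver Ω' Ω').hom (pointsTransfer_structure_square e P)) (pullback.lift_snd _ _ _),
    fun _ => pullback.lift_fst _ _ _⟩

variable {e}

/-- The second coordinate of a transferred point is forced: `ε(P) ≫ pr₂ = 𝟙` (it is an `Ω′`-point over `Spec Ω′`).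
[cite: GortzWedhorn2020, Section (4.7) (pp. 107–108)] -/
theorem pointsTransfer_left_comp_snd (Q : (A.baseChange e).toAffine.toAbelianVariety.Points Ω') :
    Q.left ≫ pullback.snd A.X.hom e = 𝟙 _ :=
  (Over.w Q).trans (specOver_self_hom (K := Ω'))

/-- **UNIQUENESS**: an `Ω′`-point `Q` of `A_{Ω′}` with `Q ≫ pr_A = e ≫ P` IS the transfer of `P`. [cite: GortzWedhorn2020, Section (4.7) (pp. 107–108)] -/
theorem pointsTransfer_ext {ε : A.toAffine.toAbelianVariety.Points Ω → (A.baseChange e).toAffine.toAbelianVariety.Points Ω'}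
    (hε : ∀ P, (ε P).left ≫ pullback.fst A.X.hom e = e ≫ P.left) (P : A.toAffine.toAbelianVariety.Points Ω)
    (Q : (A.baseChange e).toAffine.toAbelianVariety.Points Ω') (hQ : Q.left ≫ pullback.fst A.X.hom e = e ≫ P.left) : Q = ε P := by
  apply Over.OverMorphism.ext
  apply pullback.hom_ext
  · rw [hQ, hε]
  · rw [pointsTransfer_left_comp_snd, pointsTransfer_left_comp_snd]

/-- **NATURALITY**: `ε_B (f P) = f_{Ω′} (ε_A P)` for every morphism `f : A → B` over `Spec Ω`. [cite: MumfordFogartyKirwan1994, Ch. 6 §1 Corollary 6.4 (p. 117)]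
[cite: GortzWedhorn2020, Section (4.7) (pp. 107–108)] -/
theorem pointsTransfer_map {εA : A.toAffine.toAbelianVariety.Points Ω → (A.baseChange e).toAffine.toAbelianVariety.Points Ω'}
    (hεA : ∀ P, (εA P).left ≫ pullback.fst A.X.hom e = e ≫ P.left)
    {εB : B.toAffine.toAbelianVariety.Points Ω → (B.baseChange e).toAffine.toAbelianVariety.Points Ω'}
    (hεB : ∀ P, (εB P).left ≫ pullback.fst B.X.hom e = e ≫ P.left) (f : A.X ⟶ B.X) (P : A.toAffine.toAbelianVariety.Points Ω) :
    εB (AlgPoints.map f P) = (AlgPoints.map (baseChangeHom f e) (εA P) : (B.baseChange e).toAffine.toAbelianVariety.Points Ω') := by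
  refine (pointsTransfer_ext hεB (AlgPoints.map f P) _ ?_).symm
  rw [AlgPoints.map_apply, AlgPoints.map_apply, Over.comp_left, Over.comp_left, Category.assoc]
  erw [baseChangeHom_left_comp_fst]
  rw [← Category.assoc]
  erw [hεA]
  exact Category.assoc _ _ _

/-- The transfer is `P ↦ ι ≫ (P ×_Ω Ω′)` for the comparison point `ι : Spec Ω′ → (Spec Ω) ×_Ω Spec Ω′` (so it is MULTIPLICATIVE: base change is a monoidal
functor). [cite: MumfordFogartyKirwan1994, Ch. 6 §1 Corollary 6.4 (p. 117)] -/
theorem pointsTransfer_eq_comp_pullback_map {ε : A.toAffine.toAbelianVariety.Points Ω → (A.baseChange e).toAffine.toAbelianVariety.Points Ω'}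
    (hε : ∀ P, (ε P).left ≫ pullback.fst A.X.hom e = e ≫ P.left) :
    ∃ jpt : specOver Ω' Ω' ⟶ (Over.pullback e).obj (specOver Ω Ω),
      ∀ P, ε P = jpt ≫ (Over.pullback e).map (P : specOver Ω Ω ⟶ A.X) := by
  have w : e ≫ (specOver Ω Ω).hom = (specOver Ω' Ω').hom ≫ e := by
    erw [specOver_self_hom, specOver_self_hom, Category.comp_id]
  -- the comparison point, kept opaque: only its first projection `= e` is used
  obtain ⟨jpt, hjpt⟩ : ∃ jpt : specOver Ω' Ω' ⟶ (Over.pullback e).obj (specOver Ω Ω),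
      jpt.left ≫ pullback.fst (specOver Ω Ω).hom e = e :=
    ⟨Over.homMk (pullback.lift e (specOver Ω' Ω').hom w) (pullback.lift_snd _ _ _), pullback.lift_fst _ _ _⟩
  refine ⟨jpt, fun P => (pointsTransfer_ext hε P _ ?_).symm⟩
  have h1 : ((Over.pullback e).map (P : specOver Ω Ω ⟶ A.X)).left ≫ pullback.fst A.X.hom e =
      pullback.fst (specOver Ω Ω).hom e ≫ P.left :=
    pullback.lift_fst _ _ _
  rw [Over.comp_left, Category.assoc, h1, ← Category.assoc, hjpt]

/-- **MULTIPLICATIVITY**: `ε (P · Q) = ε P · ε Q`. [cite: MumfordFogartyKirwan1994, Ch. 6 §1 Corollary 6.4 (p. 117)] -/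
theorem pointsTransfer_mul {ε : A.toAffine.toAbelianVariety.Points Ω → (A.baseChange e).toAffine.toAbelianVariety.Points Ω'}
    (hε : ∀ P, (ε P).left ≫ pullback.fst A.X.hom e = e ≫ P.left) (P Q : A.toAffine.toAbelianVariety.Points Ω) :
    ε (P * Q) = ε P * ε Q := by
  obtain ⟨jpt, hj⟩ := pointsTransfer_eq_comp_pullback_map hε
  rw [hj, hj, hj, Functor.map_mul, MonObj.comp_mul]

/-- **UNIT**: `ε 1 = 1`. [cite: MumfordFogartyKirwan1994, Ch. 6 §1 Corollary 6.4 (p. 117)] -/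
theorem pointsTransfer_one {ε : A.toAffine.toAbelianVariety.Points Ω → (A.baseChange e).toAffine.toAbelianVariety.Points Ω'}
    (hε : ∀ P, (ε P).left ≫ pullback.fst A.X.hom e = e ≫ P.left) : ε 1 = 1 := by
  obtain ⟨jpt, hj⟩ := pointsTransfer_eq_comp_pullback_map hε
  rw [hj, Functor.map_one, MonObj.comp_one]

/-- **INJECTIVITY** (for `e` an epimorphism, e.g. any morphism of spectra of fields — we assume `IsIso e`). [cite: GortzWedhorn2020, Prop. 4.16 (p. 101)] -/
theorem pointsTransfer_injective [IsIso e] {ε : A.toAffine.toAbelianVariety.Points Ω → (A.baseChange e).toAffine.toAbelianVariety.Points Ω'}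
    (hε : ∀ P, (ε P).left ≫ pullback.fst A.X.hom e = e ≫ P.left) : Function.Injective ε := by
  intro P Q hPQ
  apply Over.OverMorphism.ext
  rw [← cancel_epi e, ← hε P, ← hε Q, hPQ]

/-- **SURJECTIVITY for `e` an isomorphism**: every `Ω′`-point of `A_{Ω′}` is the transfer of `e⁻¹ ≫ (its projection to `A`)`.
[cite: GortzWedhorn2020, Prop. 4.16 (p. 101)] -/
theorem pointsTransfer_surjective_of_isIso [IsIso e]
    {ε : A.toAffine.toAbelianVariety.Points Ω → (A.baseChange e).toAffine.toAbelianVariety.Points Ω'}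
    (hε : ∀ P, (ε P).left ≫ pullback.fst A.X.hom e = e ≫ P.left) : Function.Surjective ε := by
  intro Q
  have w : (inv e ≫ Q.left ≫ pullback.fst A.X.hom e) ≫ A.X.hom = (specOver Ω Ω).hom := by
    rw [Category.assoc, Category.assoc, pullback.condition, reassoc_of% (pointsTransfer_left_comp_snd Q), IsIso.inv_hom_id, specOver_self_hom]
  refine ⟨Over.homMk (inv e ≫ Q.left ≫ pullback.fst A.X.hom e) w, (pointsTransfer_ext hε _ Q ?_).symm⟩
  change Q.left ≫ pullback.fst A.X.hom e = e ≫ inv e ≫ Q.left ≫ pullback.fst A.X.hom e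
  rw [IsIso.hom_inv_id_assoc]

/-- **`ε` DETECTS THE UNIT**: `ε P = 1 ↔ P = 1` (for `e` an isomorphism). [cite: GortzWedhorn2020, Prop. 4.16 (p. 101)] -/
theorem pointsTransfer_eq_one_iff [IsIso e] {ε : A.toAffine.toAbelianVariety.Points Ω → (A.baseChange e).toAffine.toAbelianVariety.Points Ω'}
    (hε : ∀ P, (ε P).left ≫ pullback.fst A.X.hom e = e ≫ P.left) (P : A.toAffine.toAbelianVariety.Points Ω) : ε P = 1 ↔ P = 1 := by
  rw [← pointsTransfer_one hε]
  exact (pointsTransfer_injective hε).eq_iff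

/-- **KERNEL CONDITIONS TRANSFER**: `f P = 1 ↔ f_{Ω′} (ε_A P) = 1`. [cite: MumfordFogartyKirwan1994, Ch. 6 §1 Corollary 6.4 (p. 117)] -/
theorem pointsTransfer_map_eq_one_iff [IsIso e]
    {εA : A.toAffine.toAbelianVariety.Points Ω → (A.baseChange e).toAffine.toAbelianVariety.Points Ω'}
    (hεA : ∀ P, (εA P).left ≫ pullback.fst A.X.hom e = e ≫ P.left)
    {εB : B.toAffine.toAbelianVariety.Points Ω → (B.baseChange e).toAffine.toAbelianVariety.Points Ω'}
    (hεB : ∀ P, (εB P).left ≫ pullback.fst B.X.hom e = e ≫ P.left) (f : A.X ⟶ B.X) (P : A.toAffine.toAbelianVariety.Points Ω) :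
    (AlgPoints.map (baseChangeHom f e) (εA P) : (B.baseChange e).toAffine.toAbelianVariety.Points Ω') = 1 ↔
      (AlgPoints.map f P : B.toAffine.toAbelianVariety.Points Ω) = 1 := by
  rw [← pointsTransfer_map hεA hεB, pointsTransfer_eq_one_iff hεB]

/-- **TORSION PREDICATES TRANSFER**: `P` is killed by every `ι(a)`, `𝔞 a`, iff `ε P` is killed by every `ι(a)_{Ω′}`, `𝔞 a` (the `IsIdealTorsionΩ∕E` clauses).
[cite: MumfordFogartyKirwan1994, Ch. 6 §1 Corollary 6.4 (p. 117)] -/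
theorem pointsTransfer_forall_map_eq_one_iff [IsIso e]
    {εA : A.toAffine.toAbelianVariety.Points Ω → (A.baseChange e).toAffine.toAbelianVariety.Points Ω'}
    (hεA : ∀ P, (εA P).left ≫ pullback.fst A.X.hom e = e ≫ P.left) {O : Type*} (𝔞 : O → Prop) (act : O → (A.X ⟶ A.X))
    (P : A.toAffine.toAbelianVariety.Points Ω) :
    (∀ a, 𝔞 a → (AlgPoints.map (baseChangeHom (act a) e) (εA P) : (A.baseChange e).toAffine.toAbelianVariety.Points Ω') = 1) ↔
      ∀ a, 𝔞 a → (AlgPoints.map (act a) P : A.toAffine.toAbelianVariety.Points Ω) = 1 :=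
  forall₂_congr fun a _ => pointsTransfer_map_eq_one_iff hεA hεA (act a) P

end Transfer

/-! ### §2 The roof shape base-changes along an isomorphism of point bases -/

section Roof

variable {Ω Ω' : Type u} [Field Ω] [Field Ω'] {e : Spec (.of Ω') ⟶ Spec (.of Ω)} [IsIso e]
  {A₁ A₁'' : AbelianSchemeOver (Spec (.of Ω))} (D₁ : A₁.DualPair) (D₁'' : A₁''.DualPair)
  (lam₁ : A₁.X ⟶ D₁.hat.X) (lam₁'' : A₁''.X ⟶ D₁''.hat.X)
  {O : Type*} (act₁ : O → (A₁.X ⟶ A₁.X)) (act₁'' : O → (A₁''.X ⟶ A₁''.X))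
  {J : Type*} (pt₁ : J → A₁.toAffine.toAbelianVariety.Points Ω) (pt₁'' : J → A₁''.toAffine.toAbelianVariety.Points Ω)
  (tors₁'' : A₁''.toAffine.toAbelianVariety.Points Ω → Prop) (K₁ : Subgroup (A₁.toAffine.toAbelianVariety.Points Ω)) (p : ℕ)
  {ε₁ : A₁.toAffine.toAbelianVariety.Points Ω → (A₁.baseChange e).toAffine.toAbelianVariety.Points Ω'}
  (hε₁ : ∀ P, (ε₁ P).left ≫ pullback.fst A₁.X.hom e = e ≫ P.left)
  {ε₁'' : A₁''.toAffine.toAbelianVariety.Points Ω → (A₁''.baseChange e).toAffine.toAbelianVariety.Points Ω'}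
  (hε₁'' : ∀ P, (ε₁'' P).left ≫ pullback.fst A₁''.X.hom e = e ≫ P.left)
  (pt₂ : J → (A₁.baseChange e).toAffine.toAbelianVariety.Points Ω') (pt₂'' : J → (A₁''.baseChange e).toAffine.toAbelianVariety.Points Ω')
  (tors₂'' : (A₁''.baseChange e).toAffine.toAbelianVariety.Points Ω' → Prop)
  (K₂ : Subgroup ((A₁.baseChange e).toAffine.toAbelianVariety.Points Ω'))

include hε₁ hε₁'' in
/-- **THE HEAD — AN ISOGENY ROOF BASE-CHANGES ALONG AN ISOMORPHISM OF POINT BASES.**  Let `e : Spec Ω′ ⟶ Spec Ω` be an isomorphism, `ε₁`, `ε₁″`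
transfers of points for the two outer sides, and let the `Ω′`-side point data be the transferred ones (`pt₂ = ε₁ ∘ pt₁`, `pt₂″ = ε₁″ ∘ pt₁″`, `tors₂″ ∘ ε₁″ = tors₁″`,
`K₂ = ε₁(K₁)` read as `ε₁ P ∈ K₂ ↔ P ∈ K₁`).  Then an isogeny roof `A₁ —q→ B ←c— A₁″` over `Spec Ω` — (r1) `Ker q(Ω) = K₁`, (r2) `Ker c(Ω) = tors₁″`, `c`
surjective, (r3) `q^*λ_B = p·λ₁`, `c^*λ_B = p·λ₁″` (dual-homomorphism form), (r4) `ι`-equivariance through a common endomorphism of `B`, (r5) `q(pt₁ i) = c(pt₁″ i)` —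
base-changes to the isogeny roof `A₁ ×_Ω Ω′ —q_{Ω′}→ B ×_Ω Ω′ ←c_{Ω′}— A₁″ ×_Ω Ω′` over `Spec Ω′` with middle `(B_{Ω′}, B̂_{Ω′}, (λ_B)_{Ω′})` (unit pin ★
`DualPair.nonempty_unitHatSlice_baseChange_iso`), the clauses read on the transferred data ((r1)(r2)(r5) by §1, surjectivity ★ `surjective_baseChangeHom_left`,
(r3) ★ `DualPair.baseChangeHom_similitude_base`, (r4) functoriality).  The clause texts are those of ★ `roof_transport_along_iso` (= the P6a readers `RoofΩ`∕`RoofE`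
with the readers abstracted), so the X-leaf instantiates by unification. [cite: MumfordFogartyKirwan1994, Ch. 6 §1 Corollary 6.8 (p. 118) and Ch. 7 §2 Definition 7.2 (p. 129)]
[cite: GortzWedhorn2020, Section (4.7) (pp. 107–108) and Prop. 4.16 (p. 101)] [cite: MumfordAV1970, §15 Thm. 1 (p. 143)] -/
theorem roof_baseChange_of_isIso
    (hpt : ∀ i, pt₂ i = ε₁ (pt₁ i)) (hpt'' : ∀ i, pt₂'' i = ε₁'' (pt₁'' i))
    (htors : ∀ P, tors₂'' (ε₁'' P) ↔ tors₁'' P) (hK : ∀ P, ε₁ P ∈ K₂ ↔ P ∈ K₁)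
    (hroof : ∃ (B : AbelianSchemeOver (Spec (.of Ω))) (DB : B.DualPair) (lamB : B.X ⟶ DB.hat.X) (_ : IsMonHom lamB)
        (_ : Nonempty ((Scheme.Modules.pullback DB.unitHatSlice).obj DB.P ≅ SheafOfModules.unit _))
        (q : A₁.X ⟶ B.X) (_ : IsMonHom q) (c : A₁''.X ⟶ B.X) (_ : IsMonHom c),
        (∀ P : A₁.toAffine.toAbelianVariety.Points Ω,
            (AlgPoints.map q P : B.toAffine.toAbelianVariety.Points Ω) = 1 ↔ P ∈ K₁) ∧
        (∀ P : A₁''.toAffine.toAbelianVariety.Points Ω,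
            (AlgPoints.map c P : B.toAffine.toAbelianVariety.Points Ω) = 1 ↔ tors₁'' P) ∧
        Function.Surjective c.left.base ∧
        q ≫ lamB ≫ DualPair.dualIsogenyOver q D₁ DB = lam₁ ≫ D₁.hat.mulN p ∧
        c ≫ lamB ≫ DualPair.dualIsogenyOver c D₁'' DB = lam₁'' ≫ D₁''.hat.mulN p ∧
        (∀ a : O, ∃ b : B.X ⟶ B.X, act₁ a ≫ q = q ≫ b ∧ act₁'' a ≫ c = c ≫ b) ∧
        (∀ i : J, (AlgPoints.map q (pt₁ i) : B.toAffine.toAbelianVariety.Points Ω) = AlgPoints.map c (pt₁'' i))) :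
    ∃ (B : AbelianSchemeOver (Spec (.of Ω'))) (DB : B.DualPair) (lamB : B.X ⟶ DB.hat.X) (_ : IsMonHom lamB)
        (_ : Nonempty ((Scheme.Modules.pullback DB.unitHatSlice).obj DB.P ≅ SheafOfModules.unit _))
        (q : (A₁.baseChange e).X ⟶ B.X) (_ : IsMonHom q) (c : (A₁''.baseChange e).X ⟶ B.X) (_ : IsMonHom c),
        (∀ P : (A₁.baseChange e).toAffine.toAbelianVariety.Points Ω',
            (AlgPoints.map q P : B.toAffine.toAbelianVariety.Points Ω') = 1 ↔ P ∈ K₂) ∧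
        (∀ P : (A₁''.baseChange e).toAffine.toAbelianVariety.Points Ω',
            (AlgPoints.map c P : B.toAffine.toAbelianVariety.Points Ω') = 1 ↔ tors₂'' P) ∧
        Function.Surjective c.left.base ∧
        q ≫ lamB ≫ DualPair.dualIsogenyOver q (D₁.baseChange e) DB = baseChangeHom lam₁ e ≫ (D₁.baseChange e).hat.mulN p ∧
        c ≫ lamB ≫ DualPair.dualIsogenyOver c (D₁''.baseChange e) DB = baseChangeHom lam₁'' e ≫ (D₁''.baseChange e).hat.mulN p ∧
        (∀ a : O, ∃ b : B.X ⟶ B.X, baseChangeHom (act₁ a) e ≫ q = q ≫ b ∧ baseChangeHom (act₁'' a) e ≫ c = c ≫ b) ∧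
        (∀ i : J, (AlgPoints.map q (pt₂ i) : B.toAffine.toAbelianVariety.Points Ω') = AlgPoints.map c (pt₂'' i)) := by
  obtain ⟨B, DB, lamB, hlamB, hpin, q, hq, c, hc, r1, r2, hsurj, r3q, r3c, r4, r5⟩ := hroof
  haveI := hlamB
  haveI := hq
  haveI := hc
  haveI : Surjective c.left := ⟨hsurj⟩
  haveI := isMonHom_baseChangeHom lamB e
  haveI := isMonHom_baseChangeHom q e
  haveI := isMonHom_baseChangeHom c e
  -- the transfer of points for the middle
  obtain ⟨εB, hεB⟩ := exists_pointsTransfer e B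
  refine ⟨B.baseChange e, DB.baseChange e, baseChangeHom lamB e, isMonHom_baseChangeHom lamB e,
    DualPair.nonempty_unitHatSlice_baseChange_iso DB hpin, baseChangeHom q e, isMonHom_baseChangeHom q e, baseChangeHom c e,
    isMonHom_baseChangeHom c e, fun P' => ?_, fun P' => ?_, (surjective_baseChangeHom_left e c).1,
    DualPair.baseChangeHom_similitude_base e q D₁ DB lam₁ lamB p r3q, DualPair.baseChangeHom_similitude_base e c D₁'' DB lam₁'' lamB p r3c,
    fun a => ?_, fun i => ?_⟩
  · -- (r1) on the transferred points
    obtain ⟨P, rfl⟩ := pointsTransfer_surjective_of_isIso hε₁ P'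
    rw [pointsTransfer_map_eq_one_iff hε₁ hεB q P, r1 P, hK P]
  · -- (r2)
    obtain ⟨P, rfl⟩ := pointsTransfer_surjective_of_isIso hε₁'' P'
    rw [pointsTransfer_map_eq_one_iff hε₁'' hεB c P, r2 P, htors P]
  · -- (r4): the common endomorphism base-changes
    obtain ⟨b, hbq, hbc⟩ := r4 a
    refine ⟨baseChangeHom b e, ?_, ?_⟩
    · change (Over.pullback e).map (act₁ a) ≫ (Over.pullback e).map q = (Over.pullback e).map q ≫ (Over.pullback e).map b
      rw [← Functor.map_comp, ← Functor.map_comp, hbq]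
    · change (Over.pullback e).map (act₁'' a) ≫ (Over.pullback e).map c = (Over.pullback e).map c ≫ (Over.pullback e).map b
      rw [← Functor.map_comp, ← Functor.map_comp, hbc]
  · -- (r5): the level points correspond
    rw [hpt, hpt'', ← pointsTransfer_map hε₁ hεB q, ← pointsTransfer_map hε₁'' hεB c, r5 i]

end Roof

end AbelianSchemeOver

end Literature.AlgebraicGeometry.AbelianSchemes

end
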